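import Literature.NumberTheory.DiophantineGeometry.GenEllFullGalois
import Literature.IUT.LogVolume.RArithmeticDivisorsPullback
import Mathlib.NumberTheory.RamificationInertia.Galois
import Mathlib.NumberTheory.NumberField.Ideal.Basic
import HarnessLib

/-!
# [GenEll] Thm. 3.8, proof, step 1: ramification indices of `L′/L` divide `[L′:L]` (Galois case)

S. Mochizuki, *Arithmetic elliptic curves in general position*, Math. J. Okayama Univ. 52 (2010)
[cite: MochizukiGenEll2010], proof of Theorem 3.8, p. 20: "there exists a Galois extension `L′` of `L`
of degree that divides `d₀ = 23040` […] passing to such a Galois extension of `L` only affects the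
prime decomposition of the local heights via the primes that divide `d₀`".  With
`h_w(E_{L′}) = e(w|v) · h_v(E)` (`GenEllBaseChangeInvariants.lean`) the point is that for `L′/L`
GALOIS every ramification index `e(w|v)` divides `[L′:L]` (fundamental identity `efg = [L′:L]`).

Topic `NumberTheory/DiophantineGeometry`.  Theorem-only file (no definition, no named fact):

* `ramificationIdx'_finBelow_dvd_finrank` — `e(w|v) ∣ [L′:L]` for `L′/L` Galois;
* `not_dvd_ramificationIdx'_finBelow` — hence a prime `l ∤ [L′:L]` divides no `e(w|v)`.

## References

* S. Mochizuki, op. cit., proof of Thm. 3.8, p. 20. [MochizukiGenEll2010]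
-/

noncomputable section

open NumberField IsDedekindDomain

namespace Literature.NumberTheory.DiophantineGeometry.GenEll

open Literature.IUT.LogVolume

variable (F L' : Type*) [Field F] [NumberField F] [Field L'] [NumberField L'] [Algebra F L']

/-- **`e(w|v) ∣ [L′:L]` for a Galois extension `L′/L` of number fields** and finite primes `w | v`
(the fundamental identity `g · e · f = [L′:L]` in the Galois case, Mathlib
`Ideal.ncard_primesOver_mul_ramificationIdxIn_mul_inertiaDegIn`).
[cite: MochizukiGenEll2010, Thm 3.8 proof p.20] -/
theorem ramificationIdx'_finBelow_dvd_finrank [IsGalois F L'] (w : HeightOneSpectrum (𝓞 L')) :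
    Ideal.ramificationIdx' (finBelow F L' w).asIdeal w.asIdeal ∣ Module.finrank F L' := by
  classical
  let G := L' ≃ₐ[F] L'
  haveI : IsGaloisGroup G (𝓞 F) (𝓞 L') := IsGaloisGroup.of_isFractionRing G (𝓞 F) (𝓞 L') F L'
  haveI : w.asIdeal.IsPrime := w.isPrime
  set v := finBelow F L' w with hv
  haveI : v.asIdeal.IsPrime := v.isPrime
  have hident := Ideal.ncard_primesOver_mul_ramificationIdxIn_mul_inertiaDegIn v.asIdeal (𝓞 L') G
  have hcard : Nat.card G = Module.finrank F L' := IsGalois.card_aut_eq_finrank F L'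
  have hee : v.asIdeal.ramificationIdxIn (𝓞 L') = w.asIdeal.ramificationIdx (𝓞 F) :=
    Ideal.ramificationIdxIn_eq_ramificationIdx v.asIdeal w.asIdeal G
  have he' : Ideal.ramificationIdx' v.asIdeal w.asIdeal = w.asIdeal.ramificationIdx (𝓞 F) :=
    Ideal.ramificationIdx'_eq_ramificationIdx v.asIdeal w.asIdeal v.ne_bot
  rw [he', ← hee, ← hcard, ← hident]
  exact ⟨(v.asIdeal.primesOver (𝓞 L')).ncard * v.asIdeal.inertiaDegIn (𝓞 L'), by ring⟩

/-- Hence **a prime `l` not dividing `[L′:L]` divides no ramification index `e(w|v)`** (`L′/L`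
Galois) — with `[L′:L] ∣ 23040 = 2⁸·3²·5` and `l` prime to `30` this is print's "only affects … via
the primes that divide `d₀`". [cite: MochizukiGenEll2010, Thm 3.8 proof p.20] -/
theorem not_dvd_ramificationIdx'_finBelow [IsGalois F L'] {l : ℕ}
    (hl : ¬ (l ∣ Module.finrank F L')) (w : HeightOneSpectrum (𝓞 L')) :
    ¬ (l ∣ Ideal.ramificationIdx' (finBelow F L' w).asIdeal w.asIdeal) :=
  fun h => hl (h.trans (ramificationIdx'_finBelow_dvd_finrank F L' w))

end Literature.NumberTheory.DiophantineGeometry.GenEll
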